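import Summits.CriticalPhenomena.PercolationContinuityZ3.Theorems.PercAnnulusCrossingIICCapacityEnergyIIC
import Summits.CriticalPhenomena.PercolationContinuityZ3.Theorems.PercAnnulusCrossingIICTwoPointCU
import HarnessLib

/-!
# How much of a far shape does Kesten's IIC cover when it hits it?  `c·|S|·π(m) ≤ E_ν[#(C(0) ∩ (x+S)) | hit] ≤ C·|S|·I(w)` (lane RSW3, p1 gen 26)

builds on p205010 (kernel theorem, internal audit signed; external expert review pending) — NOT used in this file (only `p_c(ℤ^d) > 0`;
hypotheses (A2)□ and `CU⁺_l`).

RSW3 lane (LANE 3 `prim-rsw3`), seat `prim-rsw3-p1` (gen 26).  Helper file (`--supports stmt-CriticalPhenomena-4575`); no definitions,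
no sorries.  Memo `run/shared/lean/prim/rsw3/P1-QM.md` §39.6.

The mean number of sites of a far shape `x + S` (`S ⊆ Λ(m)`, `2m ≤ ‖x‖`) in the IIC is `E_ν[N] = Σ_{q∈S} ν(0 ↔ x+q) ≍ |S|·π(‖x‖)` by the
two-sided two-point function of the IIC (`…IICTwoPointCU`; every site of the shape is at distance `‖x‖ ± m`).  Dividing by the hitting
probability (`…IICCapacityEnergyIIC`: `c·π(‖x‖) ≤ ν(hit)·I(w)` and `ν(hit)·π(m) ≤ C·π(‖x‖)`) gives the CONDITIONAL MEAN COVERAGE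
`E_ν[N | hit] = E_ν[N]/ν(hit)`:
* `exists_iicMeasure_sum_real_openConn_two_sided_criticalProbI` — **`c·|S|·π(‖x‖) ≤ Σ_{q∈S} ν(0 ↔ x+q) ≤ C·|S|·π(‖x‖)`** (every finite
  `S ⊆ Λ(m)`, `2m ≤ ‖x‖`, `‖x‖ ≥ n₀`);
* **`exists_iicMeasure_coverage_criticalProbI`** — **`c·|S|·π(m)·ν(hit) ≤ Σ_{q∈S} ν(0 ↔ x+q) ≤ C·|S|·I(w)·ν(hit)`** for every probability
  vector `w` on `S`: GIVEN THAT THE IIC HITS A FAR SHAPE, IT COVERS ON AVERAGE BETWEEN `c|S|π(m)` AND `C|S|·inf_w I(w)` OF ITS SITES —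
  for a ball both are `≍ m^d π(m)` (gen 23's local mass), for a needle in the saturation regime both are `≍ (m+1)π(m)` (in `ℤ³`,
  `≈ m^{0.52}` of the `m+1` sites), for `k` sparse points the upper bound is `≍ 1 + kπ(sep)`.
References: H. Kesten, PTRF 73 (1986) Thm. (8); R. Lyons, Y. Peres, *Probability on Trees and Networks* (2016) §5.3.
-/

noncomputable section

namespace Summit.CriticalPhenomena.PercolationContinuityZ3.Theorems.Crossing

open MeasureTheory Filter Topology Literature.Probability.Percolation Literature.Probability.LatticeModels
open Literature.Probability.Percolation.DCT16
open Summit.CriticalPhenomena.PercolationContinuityZ3.Theorems.SurfaceTension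

variable {d : ℕ}

open Classical in
/-- **THE MEAN NUMBER OF SITES OF A FAR SHAPE IN KESTEN'S IIC** (`p_c(ℤ^d)`, `d ≥ 2`; (A2)□; `CU⁺_l`): there are `n₀` and `0 < c, C` such that
for every IIC measure `ν`, every finite `S ⊆ Λ(m)` and every `x` with `2m ≤ ‖x‖`, `2n₀ ≤ ‖x‖`:
**`c·|S|·π(‖x‖) ≤ Σ_{q ∈ S} ν(0 ↔ x + q) ≤ C·|S|·π(‖x‖)`** (the two-sided two-point function of the IIC at every site of the shape).
[cite: Kesten1986, Thm. (8)] -/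
theorem exists_iicMeasure_sum_real_openConn_two_sided_criticalProbI (hd : 2 ≤ d) {s L : ℕ} (hs : 2 ≤ s) (hsL : s ≤ L)
    {ϰ : ℝ} (hϰ : 0 < ϰ) (hA2 : SetToSetQuasiMultAspectAt d (criticalProbI d) s L ϰ) {l : ℕ} (hl : 2 ≤ l) {cU : ℝ} (hcU : 0 < cU)
    (hCU : ∀ a : ℕ, 1 ≤ a → ∀ E : Set (BondConfig (Site d)), IsUpperSet E → MeasurableSet E →
      cU * (bondPercolation (zdGraph d) (criticalProbI d)).real E ≤ (bondPercolation (zdGraph d) (criticalProbI d)).real (E ∩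
        {ω : BondConfig (Site d) | ∀ t ∈ innerBoundary (zdGraph d) (box d a), ∀ s ∈ innerBoundary (zdGraph d) (box d (l * a)),
          ∀ t' ∈ innerBoundary (zdGraph d) (box d a), ∀ s' ∈ innerBoundary (zdGraph d) (box d (l * a)),
          ω ∈ openConnIn (↑((box d (l * a) \ box d a) ∪ innerBoundary (zdGraph d) (box d a)) : Set (Site d)) t s →
          ω ∈ openConnIn (↑((box d (l * a) \ box d a) ∪ innerBoundary (zdGraph d) (box d a)) : Set (Site d)) t' s' →
          ω ∈ openConnIn (↑((box d (l * a) \ box d a) ∪ innerBoundary (zdGraph d) (box d a)) : Set (Site d)) s s'})) :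
    ∃ (n₀ : ℕ) (c C : ℝ), 1 ≤ n₀ ∧ 0 < c ∧ 0 < C ∧ ∀ (ν : Measure (BondConfig (Site d))) [IsFiniteMeasure ν],
      (∀ (F : Finset (Sym2 (Site d))) (E : Set (BondConfig (Site d))), MeasurableSet E → DeterminedBy E ↑F →
        Tendsto (fun n : ℕ => (bondPercolation (zdGraph d) (criticalProbI d)).real (E ∩ siteToBoundary d n) /
          oneArmProb d (criticalProbI d) n) atTop (𝓝 (ν.real E))) →
      ∀ (m : ℕ) (S : Finset (Site d)) (x : Site d), S ⊆ box d m → 2 * m ≤ Site.supNorm x → 2 * n₀ ≤ Site.supNorm x →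
        c * (S.card : ℝ) * oneArmProb d (criticalProbI d) (Site.supNorm x) ≤ ∑ q ∈ S, ν.real (openConn 0 (q + x)) ∧
          ∑ q ∈ S, ν.real (openConn 0 (q + x)) ≤ C * (S.card : ℝ) * oneArmProb d (criticalProbI d) (Site.supNorm x) := by
  obtain ⟨n₀, c, C, hn₀, hc, hC, htp⟩ := exists_iicMeasure_real_openConn_two_sided_noDecay_criticalProbI hd hs hsL hϰ hA2 hl hcU hCU
  obtain ⟨B, hB, hR⟩ := Rsw3.exists_oneArmProb_ratio_of_setToSetQuasiMultAspectAt hd hs hsL hϰ hA2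
  refine ⟨n₀, c / B, C * B, hn₀, by positivity, by positivity, fun ν _ hν m S x hS hm hx => ?_⟩
  set n := Site.supNorm x with hn
  have hterm : ∀ q ∈ S, c / B * oneArmProb d (criticalProbI d) n ≤ ν.real (openConn 0 (q + x)) ∧
      ν.real (openConn 0 (q + x)) ≤ C * B * oneArmProb d (criticalProbI d) n := by
    intro q hq
    have h1 := mem_box_iff_supNorm_le.1 (hS hq)
    have h2 : Site.supNorm (q + x) ≤ Site.supNorm q + Site.supNorm x := Site.supNorm_add_le q x
    have h3 : Site.supNorm x ≤ Site.supNorm (q + x) + Site.supNorm q := by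
      have h := Site.supNorm_add_le (q + x) (-q)
      rwa [Site.supNorm_neg, add_neg_cancel_comm] at h
    have hy0 : n₀ ≤ Site.supNorm (q + x) := by omega
    obtain ⟨hlo, hhi⟩ := htp ν hν (Site.supNorm (q + x)) (q + x) hy0 (mem_sphere.2 rfl)
    have hup' : oneArmProb d (criticalProbI d) (Site.supNorm (q + x)) ≤ B * oneArmProb d (criticalProbI d) n := by
      by_cases hyn : Site.supNorm (q + x) ≤ n
      · exact hR _ _ (by omega) hyn (by omega)
      · have hB1 : oneArmProb d (criticalProbI d) n ≤ B * oneArmProb d (criticalProbI d) n := hR n n (by omega) le_rfl (by omega)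
        exact (real_siteToBoundary_antitone _ (by omega)).trans hB1
    have hlo' : oneArmProb d (criticalProbI d) n ≤ B * oneArmProb d (criticalProbI d) (Site.supNorm (q + x)) := by
      by_cases hyn : n ≤ Site.supNorm (q + x)
      · exact hR _ _ (by omega) hyn (by omega)
      · have hB1 : oneArmProb d (criticalProbI d) (Site.supNorm (q + x)) ≤ B * oneArmProb d (criticalProbI d) (Site.supNorm (q + x)) :=
          hR _ _ (by omega) le_rfl (by omega)
        exact (real_siteToBoundary_antitone _ (by omega)).trans hB1
    constructor
    · rw [div_mul_eq_mul_div, div_le_iff₀ hB]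
      calc c * oneArmProb d (criticalProbI d) n ≤ c * (B * oneArmProb d (criticalProbI d) (Site.supNorm (q + x))) :=
            mul_le_mul_of_nonneg_left hlo' hc.le
        _ = c * oneArmProb d (criticalProbI d) (Site.supNorm (q + x)) * B := by ring
        _ ≤ ν.real (openConn 0 (q + x)) * B := mul_le_mul_of_nonneg_right hlo hB.le
    · calc ν.real (openConn 0 (q + x)) ≤ C * oneArmProb d (criticalProbI d) (Site.supNorm (q + x)) := hhi
        _ ≤ C * (B * oneArmProb d (criticalProbI d) n) := mul_le_mul_of_nonneg_left hup' hC.le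
        _ = C * B * oneArmProb d (criticalProbI d) n := by ring
  constructor
  · calc c / B * (S.card : ℝ) * oneArmProb d (criticalProbI d) n = ∑ q ∈ S, c / B * oneArmProb d (criticalProbI d) n := by
          rw [Finset.sum_const, nsmul_eq_mul]; ring
      _ ≤ ∑ q ∈ S, ν.real (openConn 0 (q + x)) := Finset.sum_le_sum fun q hq => (hterm q hq).1
  · calc ∑ q ∈ S, ν.real (openConn 0 (q + x)) ≤ ∑ q ∈ S, C * B * oneArmProb d (criticalProbI d) n :=
          Finset.sum_le_sum fun q hq => (hterm q hq).2
      _ = C * B * (S.card : ℝ) * oneArmProb d (criticalProbI d) n := by rw [Finset.sum_const, nsmul_eq_mul]; ring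

open Classical in
/-- **THE MEAN COVERAGE OF A FAR SHAPE BY KESTEN'S IIC, GIVEN THAT IT IS HIT** (`p_c(ℤ^d)`, `d ≥ 2`; (A2)□; `CU⁺_l`): there are `n₀` and
`0 < c, C` such that for every IIC probability measure `ν`, every `m ≥ 1`, finite `S ⊆ Λ(m)`, `x` with `l(l(m+1)+2) ≤ ‖x‖`, `2m ≤ ‖x‖`,
`2n₀ ≤ ‖x‖`, and every probability vector `w` on `S`, writing `hit = {∃ q ∈ x+S, 0 ↔ q}` and `I(w) = Σ w_q w_q' π(⌊(‖q'−q‖−1)/2⌋)`: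
**`c·|S|·π(m)·ν(hit) ≤ Σ_{q∈S} ν(0 ↔ x+q) ≤ C·|S|·I(w)·ν(hit)`** — `E_ν[#(C(0) ∩ (x+S)) | hit] ∈ [c|S|π(m), C|S|·inf_w I(w)]`.
[cite: Kesten1986, Thm. (8)] [cite: LyonsPeres2016, §5.3 Prop. 5.11] -/
theorem exists_iicMeasure_coverage_criticalProbI (hd : 2 ≤ d) {s L : ℕ} (hs : 2 ≤ s) (hsL : s ≤ L)
    {ϰ : ℝ} (hϰ : 0 < ϰ) (hA2 : SetToSetQuasiMultAspectAt d (criticalProbI d) s L ϰ) {l : ℕ} (hl : 2 ≤ l) {cU : ℝ} (hcU : 0 < cU)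
    (hCU : ∀ a : ℕ, 1 ≤ a → ∀ E : Set (BondConfig (Site d)), IsUpperSet E → MeasurableSet E →
      cU * (bondPercolation (zdGraph d) (criticalProbI d)).real E ≤ (bondPercolation (zdGraph d) (criticalProbI d)).real (E ∩
        {ω : BondConfig (Site d) | ∀ t ∈ innerBoundary (zdGraph d) (box d a), ∀ s ∈ innerBoundary (zdGraph d) (box d (l * a)),
          ∀ t' ∈ innerBoundary (zdGraph d) (box d a), ∀ s' ∈ innerBoundary (zdGraph d) (box d (l * a)),
          ω ∈ openConnIn (↑((box d (l * a) \ box d a) ∪ innerBoundary (zdGraph d) (box d a)) : Set (Site d)) t s →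
          ω ∈ openConnIn (↑((box d (l * a) \ box d a) ∪ innerBoundary (zdGraph d) (box d a)) : Set (Site d)) t' s' →
          ω ∈ openConnIn (↑((box d (l * a) \ box d a) ∪ innerBoundary (zdGraph d) (box d a)) : Set (Site d)) s s'})) :
    ∃ (n₀ : ℕ) (c C : ℝ), 1 ≤ n₀ ∧ 0 < c ∧ 0 < C ∧ ∀ (ν : Measure (BondConfig (Site d))) [IsProbabilityMeasure ν],
      (∀ (F : Finset (Sym2 (Site d))) (E : Set (BondConfig (Site d))), MeasurableSet E → DeterminedBy E ↑F →
        Tendsto (fun n : ℕ => (bondPercolation (zdGraph d) (criticalProbI d)).real (E ∩ siteToBoundary d n) /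
          oneArmProb d (criticalProbI d) n) atTop (𝓝 (ν.real E))) →
      ∀ (m : ℕ) (S : Finset (Site d)) (x : Site d) (w : Site d → ℝ), 1 ≤ m → S ⊆ box d m → l * (l * (m + 1) + 2) ≤ Site.supNorm x →
        2 * m ≤ Site.supNorm x → 2 * n₀ ≤ Site.supNorm x → (∀ q ∈ S, 0 ≤ w q) → ∑ q ∈ S, w q = 1 →
        c * (S.card : ℝ) * oneArmProb d (criticalProbI d) m *
            ν.real {ω | ∃ q ∈ S.image (· + x), ω ∈ (openConn (0 : Site d) q : Set (BondConfig (Site d)))} ≤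
          ∑ q ∈ S, ν.real (openConn 0 (q + x)) ∧
        ∑ q ∈ S, ν.real (openConn 0 (q + x)) ≤
          C * (S.card : ℝ) * (∑ q ∈ S, ∑ q' ∈ S, w q * w q' * oneArmProb d (criticalProbI d) ((Site.supNorm (q' - q) - 1) / 2)) *
            ν.real {ω | ∃ q ∈ S.image (· + x), ω ∈ (openConn (0 : Site d) q : Set (BondConfig (Site d)))} := by
  classical
  have hd1 : 1 ≤ d := le_trans (by norm_num) hd
  have hp : 0 < ((criticalProbI d : unitInterval) : ℝ) := by
    rw [coe_criticalProbI]; exact criticalProb_zd_pos d hd1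
  have hπ : ∀ m : ℕ, 0 < oneArmProb d (criticalProbI d) m := fun m => oneArmProb_pos hd1 _ hp m
  obtain ⟨n₀, c₁, C₁, hn₀, hc₁, hC₁, hsum⟩ := exists_iicMeasure_sum_real_openConn_two_sided_criticalProbI hd hs hsL hϰ hA2 hl hcU hCU
  obtain ⟨c₂, hc₂, henergy⟩ := exists_iicMeasure_oneArmProb_le_real_hit_mul_energy_criticalProbI hd hs hsL hϰ hA2 hl hcU hCU
  obtain ⟨C₂, hC₂, hupper⟩ := exists_iicMeasure_upper_of_setLink_bound hd hs hsL hϰ hA2 hl hcU hCU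
  refine ⟨n₀, c₁ / C₂, C₁ / c₂, hn₀, by positivity, by positivity, fun ν _ hν m S x w hm hS hx h2m hn hw0 hw1 => ?_⟩
  set n := Site.supNorm x with hn'
  set H := ν.real {ω | ∃ q ∈ S.image (· + x), ω ∈ (openConn (0 : Site d) q : Set (BondConfig (Site d)))} with hH
  set I := ∑ q ∈ S, ∑ q' ∈ S, w q * w q' * oneArmProb d (criticalProbI d) ((Site.supNorm (q' - q) - 1) / 2) with hI
  obtain ⟨hlo, hhi⟩ := hsum ν hν m S x hS h2m hn
  have hball := (hupper ν hν m S x hm hS hx).2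
  rw [← hH, ← hn'] at hball
  have hen := henergy ν hν m S x w hm hS hx hw0 hw1
  rw [← hH, ← hn', ← hI] at hen
  have hcard : 0 ≤ (S.card : ℝ) := Nat.cast_nonneg _
  have hH0 : 0 ≤ H := measureReal_nonneg
  have hI0 : 0 ≤ I := Finset.sum_nonneg fun q hq => Finset.sum_nonneg fun q' hq' =>
    mul_nonneg (mul_nonneg (hw0 q hq) (hw0 q' hq')) (hπ _).le
  constructor
  · -- `c₁ |S| π(n) ≤ Σ` and `H π(m) ≤ C₂ π(n)`
    have h1 : c₁ / C₂ * (S.card : ℝ) * oneArmProb d (criticalProbI d) m * H ≤ c₁ * (S.card : ℝ) * oneArmProb d (criticalProbI d) n := by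
      have h := mul_le_mul_of_nonneg_left hball (mul_nonneg (div_nonneg hc₁.le hC₂.le) hcard)
      calc c₁ / C₂ * (S.card : ℝ) * oneArmProb d (criticalProbI d) m * H = c₁ / C₂ * (S.card : ℝ) * (H * oneArmProb d (criticalProbI d) m) := by
            ring
        _ ≤ c₁ / C₂ * (S.card : ℝ) * (C₂ * oneArmProb d (criticalProbI d) n) := h
        _ = c₁ * (S.card : ℝ) * oneArmProb d (criticalProbI d) n := by field_simp
    exact h1.trans hlo
  · -- `Σ ≤ C₁ |S| π(n)` and `c₂ π(n) ≤ H I`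
    refine hhi.trans ?_
    have h := mul_le_mul_of_nonneg_left hen (mul_nonneg (div_nonneg hC₁.le hc₂.le) hcard)
    calc C₁ * (S.card : ℝ) * oneArmProb d (criticalProbI d) n = C₁ / c₂ * (S.card : ℝ) * (c₂ * oneArmProb d (criticalProbI d) n) := by
          field_simp
      _ ≤ C₁ / c₂ * (S.card : ℝ) * (H * I) := h
      _ = C₁ / c₂ * (S.card : ℝ) * I * H := by ring

end Summit.CriticalPhenomena.PercolationContinuityZ3.Theorems.Crossing

end
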